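import Summits.QuantumFields.YangMills.Theorems.LangevinControlUVFemtoCurvatureTwoPointOffAxisDomination
import Summits.QuantumFields.YangMills.Theorems.LangevinControlUVFemtoCurvatureTwoPointDiagFamilies
import Summits.QuantumFields.YangMills.Theorems.LangevinControlUVFemtoCurvatureTwoPointAxisCovNonneg
import Summits.QuantumFields.YangMills.Theorems.LangevinControlUVFemtoCurvatureTwoPointCStubTorusGeometry
import Summits.QuantumFields.YangMills.Theorems.LangevinControlUVFemtoCurvatureTwoPointCStubWindowRatio
import Summits.QuantumFields.YangMills.Theorems.LangevinControlUVFemtoCurvatureTwoPointCStubProfileFold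
import Summits.QuantumFields.YangMills.Theorems.LangevinControlUVFemtoCurvatureTwoPointCStubFoldArith
import Summits.QuantumFields.YangMills.Theorems.LangevinControlUVFemtoCurvatureTwoPointCStubScaleArith

/-!
# Stub `stub_pairsOfProfiles` for line `Sketch` of crux `FemtoCurvatureTwoPointC` (stmt-QuantumFields-16204): pairs from profiles

Continuation lead `prover-line-stmt-QuantumFields-16204-c3-0`, reshape v4 (`--supports stmt-QuantumFields-16204`). The bridge of
skeleton v4: for every compact `G`, continuous `ρ`, and box coupling `u` with in-window comparability, on a window torus `L`
the ALL-PAIRS clause of the physics statement `AFCouplingAt`,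

  `|Cov_{L,β}(P_x^{ij}, P_y^{i'j'})|·dist(x,y)⁸ ≤ 3·2¹⁸·C·u(max 8 (min L (8⌈dist⌉)), β)²`,

follows from the TRANSVERSE profile bound `s⁸ f_L(s) ≤ C u(…)²`, the LONGITUDINAL profile bound `s⁸ |g_L(s)| ≤ C u(…)²`
(`1 ≤ s ≤ L/2`) and the variance ceiling `Var_L(P^{01}) ≤ C u(8)²`. Route (all inputs LANDED):

1. `stub_torusGeometry`: direction `μ` of largest coordinate separation `m ≥ 1`, `m ≤ dist ≤ 2m`, `m ≤ ⌈dist⌉ ≤ 2m`;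
2. off-axis domination `FemtoCurvatureTwoPoint.stub_offAxisDomination` (reflection positivity, p108776):
   `Cov² ≤ (Σ_{t<3} |D^{ij}_μ(m−1+t)|)·(Σ_{t<3} |D^{i'j'}_μ(m−1+t)|)`;
3. each diagonal term is a transverse or longitudinal profile value (`FemtoCurvatureTwoPoint.diagFamilies_two_profiles`,
   p105493) at the folded separation `s' = min (s % L) (L − s % L)` (`stub_profileFold`), where either `s' = 0` (variance; then
   `m = 1`) or `1 ≤ s'`, `m ≤ 2s'`, `s' ≤ 4m`, `2s' ≤ L` (`stub_foldArith`); the transverse profile is `≥ 0`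
   (`FemtoCurvatureTwoPoint.stub_axisCovNonneg`), so all three clauses give `|D| ≤ C·u(scale)²/s'⁸` (or `≤ C u(8)²`);
4. the scales `max 8 (min L (8 s'))`, `8` and `max 8 (min L (8⌈dist⌉))` are within a factor `4` (`stub_scaleArith`), so
   `u²` moves by at most `4` (`stub_windowRatio`), and `1/s'⁸ ≤ 2⁸/m⁸`: every term is `≤ 2¹⁰ C u(M⋆)²/m⁸`;
5. hence `|Cov| ≤ 3·2¹⁰ C u(M⋆)²/m⁸` and `dist⁸ ≤ 2⁸ m⁸`.

No physics is used or asserted; the file is sorry-free.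
-/

set_option autoImplicit false

noncomputable section

open Literature.MathematicalPhysics.QuantumFieldTheory

namespace Summit.QuantumFields.YangMills.Theorems.FemtoCurvatureTwoPointC

section Helpers

variable {G : Type} [Group G] [TopologicalSpace G] [IsTopologicalGroup G] [CompactSpace G]
  [MeasurableSpace G] [BorelSpace G] {N : ℕ} (ρ : G →* Matrix (Fin N) (Fin N) ℂ)

/-- The transverse profile `Cov_{L,β}(P_0^{01}, P_{n e₂}^{01})` is non-negative (`β ≥ 0`), in the crux's abstract
`P`/`E` vocabulary (wrapper of the landed `FemtoCurvatureTwoPoint.stub_axisCovNonneg`). [folklore] -/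
theorem transverse_nonneg_PE (hρ : Continuous ρ) {L : ℕ} [NeZero L] {β : ℝ} (hβ : 0 ≤ β)
    (P : (Fin 4 → ZMod L) → Fin 4 → Fin 4 → GaugeConfig 4 L G → ℝ) (E : (GaugeConfig 4 L G → ℝ) → ℝ)
    (hP : P = fun x i j U => (N : ℝ) - (ρ (plaquetteHolonomy U x i j)).trace.re)
    (hE : E = fun F => wilsonExpectation ρ β F) (n : ℕ) :
    0 ≤ E (fun U => P 0 0 1 U * P (Pi.single (2 : Fin 4) ((n : ℕ) : ZMod L)) 0 1 U)
      - E (P 0 0 1) * E (P (Pi.single (2 : Fin 4) ((n : ℕ) : ZMod L)) 0 1) := by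
  subst hP hE
  exact FemtoCurvatureTwoPoint.stub_axisCovNonneg L N G ρ hρ β hβ n

/-- A sum of three terms each bounded by `B` is bounded by `3B`. [folklore] -/
theorem sum_range_three_le {a : ℕ → ℝ} {B : ℝ} (h : ∀ t, t < 3 → a t ≤ B) :
    ∑ t ∈ Finset.range 3, a t ≤ 3 * B := by
  have h0 := h 0 (by norm_num)
  have h1 := h 1 (by norm_num)
  have h2 := h 2 (by norm_num)
  simp only [Finset.sum_range_succ, Finset.sum_range_zero]
  linarith

/-- `|a| ≤ b` from `a² ≤ b²` and `b ≥ 0`. [folklore] -/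
theorem abs_le_of_sq_le_sq_real {a b : ℝ} (h : a ^ 2 ≤ b ^ 2) (hb : 0 ≤ b) : |a| ≤ b :=
  abs_le_of_sq_le_sq' h hb |>.elim (fun h1 h2 => abs_le.2 ⟨h1, h2⟩)

end Helpers

/-! ## The per-term bound -/

section Term

variable {G : Type} [Group G] [TopologicalSpace G] [IsTopologicalGroup G] [CompactSpace G]
  [MeasurableSpace G] [BorelSpace G] {N : ℕ} (ρ : G →* Matrix (Fin N) (Fin N) ℂ)

/-- **Per-term bound.** On a window torus `L` at `β ≥ 0`, every diagonal covariance `D^{ab}_μ(m−1+t)`, `t < 3`, of the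
off-axis window of a pair at largest coordinate separation `m` (`1 ≤ m`, `2m ≤ L`) is bounded by
`2¹⁰·C·u(M⋆)²/m⁸`, `M⋆ = max 8 (min L (8b))`, for any `b` with `m ≤ b ≤ 2m` — from the two profile bounds, the variance
ceiling, the fold, the two-profile reduction and the window ratio. [folklore] -/
theorem diagTerm_le (hρ : Continuous ρ) (u : ℕ → ℝ → ℝ) (u₀ w κ₂ C : ℝ) (hC : 0 ≤ C) (hw₀ : w ≤ u₀)
    (hwκ : w * (|κ₂| + 1) ≤ 1 / 4) {L : ℕ} [NeZero L] {β : ℝ} (hβ : 0 ≤ β)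
    (hpos : ∀ M : ℕ, 8 ≤ M → 0 < u M β)
    (hcomp : ∀ (M M' : ℕ), 8 ≤ M → M ≤ M' → M' ≤ 2 * M →
      (∀ M'' : ℕ, 8 ≤ M'' → M'' ≤ M → u M'' β ≤ u₀) → |(u M β)⁻¹ - (u M' β)⁻¹| ≤ κ₂)
    (hwin : ∀ M : ℕ, 8 ≤ M → M ≤ L → u M β ≤ w)
    (P : (Fin 4 → ZMod L) → Fin 4 → Fin 4 → GaugeConfig 4 L G → ℝ) (E : (GaugeConfig 4 L G → ℝ) → ℝ)
    (hP : P = fun x i j U => (N : ℝ) - (ρ (plaquetteHolonomy U x i j)).trace.re)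
    (hE : E = fun F => wilsonExpectation ρ β F)
    (hTU : ∀ s : ℕ, 1 ≤ s → 2 * s ≤ L →
      (s : ℝ) ^ 8 * (E (fun U => P 0 0 1 U * P (Pi.single (2 : Fin 4) ((s : ℕ) : ZMod L)) 0 1 U)
        - E (P 0 0 1) * E (P (Pi.single (2 : Fin 4) ((s : ℕ) : ZMod L)) 0 1)) ≤
        C * u (max 8 (min L (8 * s))) β ^ 2)
    (hLU : ∀ s : ℕ, 1 ≤ s → 2 * s ≤ L →
      (s : ℝ) ^ 8 * |E (fun U => P 0 0 1 U * P (Pi.single (0 : Fin 4) ((s : ℕ) : ZMod L)) 0 1 U)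
        - E (P 0 0 1) * E (P (Pi.single (0 : Fin 4) ((s : ℕ) : ZMod L)) 0 1)| ≤
        C * u (max 8 (min L (8 * s))) β ^ 2)
    (hV : E (fun U => P 0 0 1 U * P 0 0 1 U) - E (P 0 0 1) * E (P 0 0 1) ≤ C * u 8 β ^ 2)
    {m b : ℕ} (hm1 : 1 ≤ m) (hmL : 2 * m ≤ L) (hmb : m ≤ b) (hb2m : b ≤ 2 * m)
    (a a' μ : Fin 4) (haa' : a ≠ a') (t : ℕ) (ht : t < 3) :
    |E (fun U => P 0 a a' U * P (Pi.single μ (((m - 1 + t : ℕ) : ℕ) : ZMod L)) a a' U)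
        - E (P 0 a a') * E (P (Pi.single μ (((m - 1 + t : ℕ) : ℕ) : ZMod L)) a a')| ≤
      2 ^ 10 * C * u (max 8 (min L (8 * b))) β ^ 2 / (m : ℝ) ^ 8 := by
  -- notation
  set Mstar : ℕ := max 8 (min L (8 * b)) with hMstar
  have hb1 : 1 ≤ b := hm1.trans hmb
  have hmpos : (0 : ℝ) < m := by exact_mod_cast hm1
  have hm8pos : (0 : ℝ) < (m : ℝ) ^ 8 := by positivity
  have hwin₀ : ∀ M : ℕ, 8 ≤ M → M ≤ L → u M β ≤ u₀ := fun M h8 hM => (hwin M h8 hM).trans hw₀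
  -- the window ratio between two admissible scales
  have hratio : ∀ M₁ M₂ : ℕ, 8 ≤ M₁ → 8 ≤ M₂ → M₁ ≤ L → M₂ ≤ L → M₁ ≤ 4 * M₂ → M₂ ≤ 4 * M₁ →
      u M₁ β ^ 2 ≤ 4 * u M₂ β ^ 2 := fun M₁ M₂ h1 h2 h3 h4 h5 h6 =>
    stub_windowRatio (fun M => u M β) u₀ w κ₂ L hpos hcomp hw₀ hwκ hwin M₁ M₂ h1 h2 h3 h4 h5 h6
  -- scale comparison `max 8 (min L (8 a₀)) ↔ Mstar` for `a₀` within a factor 4 of `b`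
  have hscale : ∀ a₀ : ℕ, 1 ≤ a₀ → a₀ ≤ 4 * b → b ≤ 4 * a₀ →
      u (max 8 (min L (8 * a₀))) β ^ 2 ≤ 4 * u Mstar β ^ 2 := by
    intro a₀ ha₀ hab hba
    obtain ⟨h8a, ha4b, haL, haSmall⟩ := stub_scaleArith L a₀ b ha₀ hb1 hab hba
    obtain ⟨h8b, hb4a, hbL, hbSmall⟩ := stub_scaleArith L b a₀ hb1 ha₀ hba hab
    rcases lt_or_ge L 8 with hL | hL
    · -- small torus: both scales are `8`
      rw [haSmall hL, hMstar, hbSmall hL]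
      nlinarith [sq_nonneg (u 8 β)]
    · exact hratio _ _ h8a h8b (haL hL) (hbL hL) ha4b hb4a
  -- reduce the diagonal family to a profile of the plane `01`
  obtain ⟨hTcase, hLcase⟩ :=
    FemtoCurvatureTwoPoint.diagFamilies_two_profiles G N ρ hρ L β P E hP hE a a' μ (m - 1 + t) haa'
  -- fold the separation
  have hL0 : 0 < L := Nat.pos_of_ne_zero (NeZero.ne L)
  obtain ⟨s', hs'⟩ : ∃ s' : ℕ, s' = min ((m - 1 + t) % L) (L - (m - 1 + t) % L) := ⟨_, rfl⟩
  have hfoldT := stub_profileFold G N ρ hρ L β P E hP hE 0 1 2 (m - 1 + t) zero_ne_one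
  have hfoldL := stub_profileFold G N ρ hρ L β P E hP hE 0 1 0 (m - 1 + t) zero_ne_one
  rw [← hs'] at hfoldT hfoldL
  have harith := stub_foldArith L m t hm1 hmL ht
  rw [← hs'] at harith
  -- the common final step: from `|D| ≤ C u(scale)² · (factor)` to the claim
  have hMstar_nonneg : 0 ≤ C * u Mstar β ^ 2 := mul_nonneg hC (sq_nonneg _)
  -- CASE ANALYSIS on the fold
  rcases harith with ⟨hs0, hm_eq⟩ | ⟨hs1, hm2s, hs4m, h2sL⟩
  · -- `s' = 0`: the term is the variance of `P^{01}`
    -- the variance in both profile vocabularies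
    have hvarT : E (fun U => P 0 0 1 U * P (Pi.single (2 : Fin 4) ((s' : ℕ) : ZMod L)) 0 1 U)
        - E (P 0 0 1) * E (P (Pi.single (2 : Fin 4) ((s' : ℕ) : ZMod L)) 0 1) =
        E (fun U => P 0 0 1 U * P 0 0 1 U) - E (P 0 0 1) * E (P 0 0 1) := by
      rw [hs0, Nat.cast_zero, Pi.single_zero]
    have hvarL : E (fun U => P 0 0 1 U * P (Pi.single (0 : Fin 4) ((s' : ℕ) : ZMod L)) 0 1 U)
        - E (P 0 0 1) * E (P (Pi.single (0 : Fin 4) ((s' : ℕ) : ZMod L)) 0 1) =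
        E (fun U => P 0 0 1 U * P 0 0 1 U) - E (P 0 0 1) * E (P 0 0 1) := by
      rw [hs0, Nat.cast_zero, Pi.single_zero]
    have hvar_nonneg : 0 ≤ E (fun U => P 0 0 1 U * P 0 0 1 U) - E (P 0 0 1) * E (P 0 0 1) := by
      have h := transverse_nonneg_PE ρ hρ hβ P E hP hE 0
      rwa [Nat.cast_zero, Pi.single_zero] at h
    -- the term equals the variance
    have hterm : E (fun U => P 0 a a' U * P (Pi.single μ (((m - 1 + t : ℕ) : ℕ) : ZMod L)) a a' U)
        - E (P 0 a a') * E (P (Pi.single μ (((m - 1 + t : ℕ) : ℕ) : ZMod L)) a a') =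
        E (fun U => P 0 0 1 U * P 0 0 1 U) - E (P 0 0 1) * E (P 0 0 1) := by
      by_cases hμ : μ ≠ a ∧ μ ≠ a'
      · rw [hTcase hμ, hfoldT, hvarT]
      · have hμ' : μ = a ∨ μ = a' := by tauto
        rw [hLcase hμ', hfoldL, hvarL]
    rw [hterm, abs_of_nonneg hvar_nonneg]
    -- `Var ≤ C u(8)² ≤ 4 C u(Mstar)²`, and `m = 1`
    subst hm_eq
    have h8 : u 8 β ^ 2 ≤ 4 * u Mstar β ^ 2 := by
      have h := hscale 1 le_rfl (by omega) (by omega)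
      simpa using h
    calc E (fun U => P 0 0 1 U * P 0 0 1 U) - E (P 0 0 1) * E (P 0 0 1) ≤ C * u 8 β ^ 2 := hV
      _ ≤ C * (4 * u Mstar β ^ 2) := mul_le_mul_of_nonneg_left h8 hC
      _ ≤ 2 ^ 10 * C * u Mstar β ^ 2 / ((1 : ℕ) : ℝ) ^ 8 := by
          rw [Nat.cast_one, one_pow, div_one]; nlinarith
  · -- `1 ≤ s'`: a profile value at an admissible separation
    have hs'pos : (0 : ℝ) < s' := by exact_mod_cast hs1
    have hs8pos : (0 : ℝ) < (s' : ℝ) ^ 8 := by positivity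
    -- the scale of `s'` against `Mstar`
    have hsc : u (max 8 (min L (8 * s'))) β ^ 2 ≤ 4 * u Mstar β ^ 2 :=
      hscale s' hs1 (by omega) (by omega)
    -- `1/s'⁸ ≤ 2⁸/m⁸`
    have hms : (m : ℝ) ^ 8 ≤ 2 ^ 8 * (s' : ℝ) ^ 8 := by
      have h : (m : ℝ) ≤ 2 * s' := by exact_mod_cast hm2s
      have h' : (m : ℝ) ^ 8 ≤ (2 * (s' : ℝ)) ^ 8 := pow_le_pow_left₀ hmpos.le h 8
      rw [mul_pow] at h'
      exact h'
    -- the profile bound `|prof(s')| ≤ C u(scale)² / s'⁸` in either case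
    have hprof : |E (fun U => P 0 a a' U * P (Pi.single μ (((m - 1 + t : ℕ) : ℕ) : ZMod L)) a a' U)
        - E (P 0 a a') * E (P (Pi.single μ (((m - 1 + t : ℕ) : ℕ) : ZMod L)) a a')| * (s' : ℝ) ^ 8 ≤
        C * u (max 8 (min L (8 * s'))) β ^ 2 := by
      by_cases hμ : μ ≠ a ∧ μ ≠ a'
      · rw [hTcase hμ, hfoldT, abs_of_nonneg (transverse_nonneg_PE ρ hρ hβ P E hP hE s'), mul_comm]
        exact hTU s' hs1 h2sL
      · have hμ' : μ = a ∨ μ = a' := by tauto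
        rw [hLcase hμ', hfoldL, mul_comm]
        exact hLU s' hs1 h2sL
    -- assemble
    rw [le_div_iff₀ hm8pos]
    set X := |E (fun U => P 0 a a' U * P (Pi.single μ (((m - 1 + t : ℕ) : ℕ) : ZMod L)) a a' U)
        - E (P 0 a a') * E (P (Pi.single μ (((m - 1 + t : ℕ) : ℕ) : ZMod L)) a a')| with hX
    have hX0 : 0 ≤ X := abs_nonneg _
    calc X * (m : ℝ) ^ 8 ≤ X * (2 ^ 8 * (s' : ℝ) ^ 8) := mul_le_mul_of_nonneg_left hms hX0
      _ = 2 ^ 8 * (X * (s' : ℝ) ^ 8) := by ring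
      _ ≤ 2 ^ 8 * (C * u (max 8 (min L (8 * s'))) β ^ 2) := by
          exact mul_le_mul_of_nonneg_left hprof (by norm_num)
      _ ≤ 2 ^ 8 * (C * (4 * u Mstar β ^ 2)) := by
          exact mul_le_mul_of_nonneg_left (mul_le_mul_of_nonneg_left hsc hC) (by norm_num)
      _ = 2 ^ 10 * C * u Mstar β ^ 2 := by ring

end Term

/-! ## The registered stub -/

/-- **Registered stub `stub_pairsOfProfiles` of line `Sketch` (crux `FemtoCurvatureTwoPointC`, skeleton v4; signature
verbatim): pairs from profiles.** For every compact `G`, continuous `ρ`, box coupling `u` positive beyond `β₀ ≥ 0` with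
in-window comparability, and a torus `L` in the `w`-window (`w ≤ u₀`, `w(|κ₂|+1) ≤ 1/4`) at `β ≥ β₀`: the transverse profile
bound, the longitudinal profile bound (`1 ≤ s ≤ L/2`) and the variance ceiling (`C ≥ 0`) imply
`|Cov(P_x^{ij}, P_y^{i'j'})|·dist⁸ ≤ 3·2¹⁸·C·u(max 8 (min L (8⌈dist⌉)))²` for all `x ≠ y`, `i ≠ j`, `i' ≠ j'`. Reflection
positivity (off-axis domination, p108776), hypercubic symmetry (two profiles, p105493), `f_L ≥ 0`, fold, window ratio.
[folklore] -/
theorem stub_pairsOfProfiles :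
    ∀ (G : Type) [Group G] [TopologicalSpace G] [IsTopologicalGroup G] [CompactSpace G]
        [MeasurableSpace G] [BorelSpace G] (N : ℕ) (ρ : G →* Matrix (Fin N) (Fin N) ℂ), Continuous ρ →
      ∀ (u : ℕ → ℝ → ℝ) (u₀ w β₀ κ₂ C : ℝ), 0 ≤ C → 0 ≤ β₀ → w ≤ u₀ → w * (|κ₂| + 1) ≤ 1 / 4 →
        (∀ (L : ℕ) (β : ℝ), 8 ≤ L → β₀ ≤ β → 0 < u L β) →
        (∀ (L L' : ℕ) (β : ℝ), β₀ ≤ β → 8 ≤ L → L ≤ L' → L' ≤ 2 * L →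
            (∀ M : ℕ, 8 ≤ M → M ≤ L → u M β ≤ u₀) → |(u L β)⁻¹ - (u L' β)⁻¹| ≤ κ₂) →
        (∀ (L : ℕ) [NeZero L] (β : ℝ) (s : ℕ), β₀ ≤ β → 1 ≤ s → 2 * s ≤ L →
            (∀ M : ℕ, 8 ≤ M → M ≤ L → u M β ≤ u₀) →
            ∀ (P : (Fin 4 → ZMod L) → Fin 4 → Fin 4 → GaugeConfig 4 L G → ℝ)
              (E : (GaugeConfig 4 L G → ℝ) → ℝ),
              (P = fun x i j U => (N : ℝ) - (ρ (plaquetteHolonomy U x i j)).trace.re) →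
              (E = fun F => wilsonExpectation ρ β F) →
              (s : ℝ) ^ 8 * (E (fun U => P 0 0 1 U * P (Pi.single (2 : Fin 4) ((s : ℕ) : ZMod L)) 0 1 U)
                  - E (P 0 0 1) * E (P (Pi.single (2 : Fin 4) ((s : ℕ) : ZMod L)) 0 1)) ≤
                C * u (max 8 (min L (8 * s))) β ^ 2) →
        (∀ (L : ℕ) [NeZero L] (β : ℝ) (s : ℕ), β₀ ≤ β → 1 ≤ s → 2 * s ≤ L →
            (∀ M : ℕ, 8 ≤ M → M ≤ L → u M β ≤ u₀) →
            ∀ (P : (Fin 4 → ZMod L) → Fin 4 → Fin 4 → GaugeConfig 4 L G → ℝ)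
              (E : (GaugeConfig 4 L G → ℝ) → ℝ),
              (P = fun x i j U => (N : ℝ) - (ρ (plaquetteHolonomy U x i j)).trace.re) →
              (E = fun F => wilsonExpectation ρ β F) →
              (s : ℝ) ^ 8 * |E (fun U => P 0 0 1 U * P (Pi.single (0 : Fin 4) ((s : ℕ) : ZMod L)) 0 1 U)
                  - E (P 0 0 1) * E (P (Pi.single (0 : Fin 4) ((s : ℕ) : ZMod L)) 0 1)| ≤
                C * u (max 8 (min L (8 * s))) β ^ 2) →
        (∀ (L : ℕ) [NeZero L] (β : ℝ), β₀ ≤ β → (∀ M : ℕ, 8 ≤ M → M ≤ L → u M β ≤ u₀) →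
            ∀ (P : (Fin 4 → ZMod L) → Fin 4 → Fin 4 → GaugeConfig 4 L G → ℝ)
              (E : (GaugeConfig 4 L G → ℝ) → ℝ),
              (P = fun x i j U => (N : ℝ) - (ρ (plaquetteHolonomy U x i j)).trace.re) →
              (E = fun F => wilsonExpectation ρ β F) →
              E (fun U => P 0 0 1 U * P 0 0 1 U) - E (P 0 0 1) * E (P 0 0 1) ≤ C * u 8 β ^ 2) →
        ∀ (L : ℕ) [NeZero L] (β : ℝ), β₀ ≤ β → (∀ M : ℕ, 8 ≤ M → M ≤ L → u M β ≤ w) →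
          ∀ (P : (Fin 4 → ZMod L) → Fin 4 → Fin 4 → GaugeConfig 4 L G → ℝ)
            (E : (GaugeConfig 4 L G → ℝ) → ℝ),
            (P = fun x i j U => (N : ℝ) - (ρ (plaquetteHolonomy U x i j)).trace.re) →
            (E = fun F => wilsonExpectation ρ β F) →
            ∀ (x y : Fin 4 → ZMod L) (i j i' j' : Fin 4), x ≠ y → i ≠ j → i' ≠ j' →
              |E (fun U => P x i j U * P y i' j' U) - E (P x i j) * E (P y i' j')| *
                  Real.sqrt (∑ k : Fin 4, (((x k - y k).valMinAbs : ℤ) : ℝ) ^ 2) ^ 8 ≤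
                3 * 2 ^ 18 * C *
                  u (max 8 (min L (8 * ⌈Real.sqrt (∑ k : Fin 4, (((x k - y k).valMinAbs : ℤ) : ℝ) ^ 2)⌉₊))) β ^ 2 := by
  intro G _ _ _ _ _ _ N ρ hρ u u₀ w β₀ κ₂ C hC hβ₀ hw₀ hwκ hpos hcomp hTU hLU hV L _ β hβ hwin P E hP hE
    x y i j i' j' hxy hij hij'
  have hβnn : 0 ≤ β := hβ₀.trans hβ
  have hwin₀ : ∀ M : ℕ, 8 ≤ M → M ≤ L → u M β ≤ u₀ := fun M h8 hM => (hwin M h8 hM).trans hw₀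
  -- geometry
  obtain ⟨μ, m, hm_def, hm1, hmL, -, hmd, hd2m, hmc, hc2m⟩ := stub_torusGeometry L x y hxy
  set D : ℝ := Real.sqrt (∑ k : Fin 4, (((x k - y k).valMinAbs : ℤ) : ℝ) ^ 2) with hD
  set b : ℕ := ⌈D⌉₊ with hb
  set Mstar : ℕ := max 8 (min L (8 * b)) with hMstar
  have hmpos : (0 : ℝ) < m := by exact_mod_cast hm1
  have hm8pos : (0 : ℝ) < (m : ℝ) ^ 8 := by positivity
  -- off-axis domination along `μ`
  have hOA := FemtoCurvatureTwoPoint.stub_offAxisDomination G N ρ hρ L β hβnn P E hP hE μ x y i j i' j'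
    hij hij' (by rw [← hm_def]; exact hm1)
  rw [← hm_def] at hOA
  -- the per-term bound with `B = 2¹⁰ C u(Mstar)² / m⁸`
  set B : ℝ := 2 ^ 10 * C * u Mstar β ^ 2 / (m : ℝ) ^ 8 with hB
  have hB0 : 0 ≤ B := by
    rw [hB]; exact div_nonneg (mul_nonneg (mul_nonneg (by norm_num) hC) (sq_nonneg _)) hm8pos.le
  have hterm : ∀ (a a' : Fin 4), a ≠ a' → ∀ t : ℕ, t < 3 →
      |E (fun U => P 0 a a' U * P (Pi.single μ (((m - 1 + t : ℕ) : ℕ) : ZMod L)) a a' U)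
        - E (P 0 a a') * E (P (Pi.single μ (((m - 1 + t : ℕ) : ℕ) : ZMod L)) a a')| ≤ B :=
    fun a a' haa' t ht =>
      diagTerm_le ρ hρ u u₀ w κ₂ C hC hw₀ hwκ hβnn (fun M h8 => hpos M β h8 hβ)
        (fun M M' h8 hMM' hM'M hwM => hcomp M M' β hβ h8 hMM' hM'M hwM) hwin P E hP hE
        (fun s hs hsL => hTU L β s hβ hs hsL hwin₀ P E hP hE)
        (fun s hs hsL => hLU L β s hβ hs hsL hwin₀ P E hP hE)
        (hV L β hβ hwin₀ P E hP hE) hm1 hmL hmc hc2m a a' μ haa' t ht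
  have hS1 : ∑ t ∈ Finset.range 3,
      |E (fun U => P 0 i j U * P (Pi.single μ (((m - 1 + t : ℕ) : ℕ) : ZMod L)) i j U)
        - E (P 0 i j) * E (P (Pi.single μ (((m - 1 + t : ℕ) : ℕ) : ZMod L)) i j)| ≤ 3 * B :=
    sum_range_three_le (hterm i j hij)
  have hS2 : ∑ t ∈ Finset.range 3,
      |E (fun U => P 0 i' j' U * P (Pi.single μ (((m - 1 + t : ℕ) : ℕ) : ZMod L)) i' j' U)
        - E (P 0 i' j') * E (P (Pi.single μ (((m - 1 + t : ℕ) : ℕ) : ZMod L)) i' j')| ≤ 3 * B :=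
    sum_range_three_le (hterm i' j' hij')
  -- `Cov² ≤ (3B)²`, hence `|Cov| ≤ 3B`
  have hS1nn : 0 ≤ ∑ t ∈ Finset.range 3,
      |E (fun U => P 0 i j U * P (Pi.single μ (((m - 1 + t : ℕ) : ℕ) : ZMod L)) i j U)
        - E (P 0 i j) * E (P (Pi.single μ (((m - 1 + t : ℕ) : ℕ) : ZMod L)) i j)| :=
    Finset.sum_nonneg fun t _ => abs_nonneg _
  have hS2nn : 0 ≤ ∑ t ∈ Finset.range 3,
      |E (fun U => P 0 i' j' U * P (Pi.single μ (((m - 1 + t : ℕ) : ℕ) : ZMod L)) i' j' U)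
        - E (P 0 i' j') * E (P (Pi.single μ (((m - 1 + t : ℕ) : ℕ) : ZMod L)) i' j')| :=
    Finset.sum_nonneg fun t _ => abs_nonneg _
  have hsq : (E (fun U => P x i j U * P y i' j' U) - E (P x i j) * E (P y i' j')) ^ 2 ≤ (3 * B) ^ 2 := by
    refine hOA.trans ?_
    rw [sq]
    exact mul_le_mul hS1 hS2 hS2nn (by positivity)
  have habs : |E (fun U => P x i j U * P y i' j' U) - E (P x i j) * E (P y i' j')| ≤ 3 * B :=
    abs_le_of_sq_le_sq_real hsq (by positivity)
  -- `dist⁸ ≤ 2⁸ m⁸`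
  have hD0 : 0 ≤ D := Real.sqrt_nonneg _
  have hD8 : D ^ 8 ≤ 2 ^ 8 * (m : ℝ) ^ 8 := by
    have h := pow_le_pow_left₀ hD0 hd2m 8
    rw [mul_pow] at h
    exact h
  -- conclude
  calc |E (fun U => P x i j U * P y i' j' U) - E (P x i j) * E (P y i' j')| * D ^ 8
      ≤ 3 * B * (2 ^ 8 * (m : ℝ) ^ 8) :=
        mul_le_mul habs hD8 (by positivity) (by positivity)
    _ = 3 * 2 ^ 18 * C * u Mstar β ^ 2 := by
        rw [hB]
        field_simp

end Summit.QuantumFields.YangMills.Theorems.FemtoCurvatureTwoPointC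

end
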